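import Literature.Computation.Sparse.DenseAccum
import Mathlib.LinearAlgebra.Span.Basic
import HarnessLib

/-!
# Replaying a word list through column operators, and `sl₂` residuals (compute bridge, generic)

Topic `Computation/Sparse` (sequel of `SparseFinsupp`, `DenseAccum`; fact-free, sorry-free).  A
certificate that a family of vectors lies in the closure of some SEED vectors under finitely many
column operators is most cheaply given as a WORD LIST: each new vector is `op(parent)` for an earlier
vector.  `replay` evaluates such a list with the dense accumulator of `DenseAccum` (each step lands in
a prescribed segment `[off k, off k + size k)`, "degree `k`"), failing (`none`) if any entry leaves its
segment.  Proved here, for ANY context (seeds, operators, segments):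

* **`replay_mem`** — every replayed vector lies in every submodule that contains the seeds and is
  stable under the operators `colOp K (C.op j)` (closure membership BY CONSTRUCTION — nothing about
  ranks is claimed or needed);
* **`sl2Residual_sound`** — if the residual check of a vector `w` placed in degree `k` passes, then
  `E (F w) - F (E w) = (k - c) • w` for the two distinguished operators `E = colOp K C.opE`,
  `F = colOp K C.opF` and the central charge shift `c` (for the Kummer model: `E = L_{ω₀}`, `F = Λ₀`,
  `c = 2(m-1)`, i.e. `[L_{ω₀}, Λ₀] = h` on `w`).

Sources as in `SparseFinsupp`/`DenseAccum` (COO storage; column-oriented accumulation).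
-/

namespace Literature.Computation.Sparse

open SpVec

/-- A replay context: degree segments, the operator columns (indexed by `j : ℕ`), the seeds (with
their degrees), the two distinguished operators `E`, `F` of the `sl₂` check and its shift `c`.
[cite: GolubVanLoan2013, §1.1.8 (column-oriented gaxpy: Ax as a linear combination of columns)] -/
structure ReplayCtx where
  off : ℕ → ℕ
  size : ℕ → ℕ
  op : ℕ → ℕ → SpVec
  seeds : Array (ℕ × SpVec)
  opE : ℕ → SpVec
  opF : ℕ → SpVec
  shift : ℚ

/-- A replay step: take seed number `s`, or apply operator `j` to the earlier word `par`, the result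
being placed in degree `k` (a straight-line program over column operators).
[cite: GolubVanLoan2013, §1.1.8 (column-oriented gaxpy: Ax as a linear combination of columns)] -/
inductive Step where
  | seed (s : ℕ)
  | app (k j par : ℕ)
  deriving Inhabited, Repr

/-- Apply operator column `col` to the sparse vector `w`, landing in the degree-`k` segment; `none` if
an entry leaves the segment. [cite: GolubVanLoan2013, §1.1.8 (column-oriented gaxpy: Ax as a linear combination of columns)] -/
def applyIn (C : ReplayCtx) (col : ℕ → SpVec) (k : ℕ) (w : SpVec) : Option SpVec :=
  match DSeg.accum? col (DSeg.zero (C.off k) (C.size k)) w with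
  | none => none
  | some v => some v.nonzeros

variable (K : Type*) [Field K] [CharZero K]

/-- Meaning of `applyIn`: the operator applied to the meaning. [cite: GolubVanLoan2013, §1.1.8 (column-oriented gaxpy: Ax as a linear combination of columns)] -/
theorem toF_applyIn {C : ReplayCtx} {col : ℕ → SpVec} {k : ℕ} {w w' : SpVec}
    (h : applyIn C col k w = some w') : toF K w' = colOp K col (toF K w) := by
  unfold applyIn at h
  split at h
  · exact absurd h (by simp)
  · next v hv =>
    simp only [Option.some.injEq] at h
    subst h
    rw [DSeg.toF_nonzeros, DSeg.toFD_accum? K hv, DSeg.toFD_zero, zero_add]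

/-- Replay a step list, appending (degree, vector) pairs; `none` on any out-of-segment entry.
[cite: GolubVanLoan2013, §1.1.8 (column-oriented gaxpy: Ax as a linear combination of columns)] -/
def replay (C : ReplayCtx) : List Step → Array (ℕ × SpVec) → Option (Array (ℕ × SpVec))
  | [], W => some W
  | Step.seed s :: t, W => replay C t (W.push (C.seeds.getD s (0, [])))
  | Step.app k j par :: t, W =>
    match applyIn C (C.op j) k (W.getD par (0, [])).2 with
    | none => none
    | some w => replay C t (W.push (k, w))

/-- **Closure membership by construction.**  If the replay succeeds, every produced vector lies in
any submodule `S` containing (the meanings of) the vectors already present, the seeds, and stable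
under all operators `colOp K (C.op j)`. [cite: GolubVanLoan2013, §1.1.8 (column-oriented gaxpy: Ax as a linear combination of columns)] -/
theorem replay_mem {C : ReplayCtx} (S : Submodule K (ℕ →₀ K))
    (hseed : ∀ s : ℕ, toF K (C.seeds.getD s (0, [])).2 ∈ S)
    (hop : ∀ j : ℕ, ∀ v ∈ S, colOp K (C.op j) v ∈ S) :
    ∀ (steps : List Step) (W W' : Array (ℕ × SpVec)),
      (∀ i : ℕ, toF K (W.getD i (0, [])).2 ∈ S) → replay C steps W = some W' →
        ∀ i : ℕ, toF K (W'.getD i (0, [])).2 ∈ S := by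
  intro steps
  induction steps with
  | nil =>
    intro W W' hW h i
    simp only [replay, Option.some.injEq] at h
    subst h
    exact hW i
  | cons st t ih =>
    intro W W' hW h
    -- a push preserves the invariant
    have hpush : ∀ (x : ℕ × SpVec), toF K x.2 ∈ S →
        ∀ i : ℕ, toF K ((W.push x).getD i (0, [])).2 ∈ S := by
      intro x hx i
      rw [Array.getD_eq_getD_getElem?, Array.getElem?_push]
      split
      · simpa using hx
      · rw [← Array.getD_eq_getD_getElem?]; exact hW i
    cases st with
    | seed s =>
      simp only [replay] at h
      exact ih _ _ (hpush _ (hseed s)) h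
    | app k j par =>
      simp only [replay] at h
      split at h
      · exact absurd h (by simp)
      · next w hw =>
        refine ih _ _ (hpush (k, w) ?_) h
        rw [toF_applyIn K hw]
        exact hop j _ (hW par)

/-- Corollary for the replay started from the empty array. [cite: GolubVanLoan2013, §1.1.8 (column-oriented gaxpy: Ax as a linear combination of columns)] -/
theorem replay_mem_of_empty {C : ReplayCtx} (S : Submodule K (ℕ →₀ K))
    (hseed : ∀ s : ℕ, toF K (C.seeds.getD s (0, [])).2 ∈ S)
    (hop : ∀ j : ℕ, ∀ v ∈ S, colOp K (C.op j) v ∈ S)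
    {steps : List Step} {W : Array (ℕ × SpVec)} (h : replay C steps #[] = some W) (i : ℕ) :
    toF K (W.getD i (0, [])).2 ∈ S := by
  refine replay_mem K S hseed hop steps #[] W (fun i ↦ ?_) h i
  simp

/-! ### The `sl₂` residual -/

/-- The residual check for a vector `w` placed in degree `k`: compute `E(F w)`, `F(E w)` through the
segments of degrees `k ∓ 2`/`k ± 2` and test `E(F w) - F(E w) + (c - k) w = 0` after normalisation
(`dF`, `dE` = the degree shifts of `F`, `E`; for `Λ`, `L`: `-2`, `+2`, encoded as `k - 2`, `k + 2`).
[cite: LooijengaLunts1997, §1 p. 4 (the sl₂-triple (e, h, f))] -/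
def sl2Residual (C : ReplayCtx) (k : ℕ) (w : SpVec) : Bool :=
  match applyIn C C.opF (k - 2) w, applyIn C C.opE (k + 2) w with
  | some fw, some ew =>
    match applyIn C C.opE k fw, applyIn C C.opF k ew with
    | some efw, some few =>
      (normalize (efw ++ scale (-1) few ++ scale (C.shift - k) w)).isEmpty
    | _, _ => false
  | _, _ => false

/-- **Soundness of the residual check**: `E(F w) - F(E w) = (k - c) • w`. [cite: LooijengaLunts1997, §1 p. 4 (the sl₂-triple (e, h, f))] -/
theorem sl2Residual_sound {C : ReplayCtx} {k : ℕ} {w : SpVec} (h : sl2Residual C k w = true) :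
    colOp K C.opE (colOp K C.opF (toF K w)) - colOp K C.opF (colOp K C.opE (toF K w)) =
      ((k : K) - (C.shift : K)) • toF K w := by
  unfold sl2Residual at h
  split at h
  · next fw ew hfw hew =>
    split at h
    · next efw few hefw hfew =>
      rw [List.isEmpty_iff] at h
      have hz := toF_eq_zero_of_normalize_eq_nil K h
      rw [toF_append, toF_append, toF_scale, toF_scale, toF_applyIn K hefw, toF_applyIn K hfew,
        toF_applyIn K hfw, toF_applyIn K hew] at hz
      rw [Rat.cast_sub, Rat.cast_natCast, Rat.cast_neg, Rat.cast_one] at hz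
      -- `a + (-1) • b + (c - k) • w = 0`  ⇒  `a - b = (k - c) • w`
      set a := colOp K C.opE (colOp K C.opF (toF K w)) with ha
      set b := colOp K C.opF (colOp K C.opE (toF K w)) with hb
      have key : a - b - ((k : K) - (C.shift : K)) • toF K w =
          a + (-1 : K) • b + ((C.shift : K) - (k : K)) • toF K w := by
        simp only [sub_smul, neg_one_smul]
        abel
      exact sub_eq_zero.mp (key.trans hz)
    · exact absurd h (by simp)
  · exact absurd h (by simp)

/-! ### Identities on basis vectors, by pure list computation (for small columns) -/

/-- The diagonal "degree" operator column: `δ_i ↦ hdeg(i) δ_i`. [cite: LooijengaLunts1997, §1 p. 4 (the degree operator h of a graded module)] -/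
def diagCol (hdeg : ℕ → ℚ) (i : ℕ) : SpVec := [(i, hdeg i)]

omit [CharZero K] in
/-- The diagonal operator on a basis vector. [cite: LooijengaLunts1997, §1 p. 4 (the degree operator h of a graded module)] -/
theorem colOp_diagCol_single (hdeg : ℕ → ℚ) (i : ℕ) (c : K) :
    colOp K (diagCol hdeg) (Finsupp.single i c) = (hdeg i : K) • Finsupp.single i c := by
  rw [colOp_single, diagCol, toF_cons, toF_nil, add_zero, Finsupp.smul_single, Finsupp.smul_single,
    smul_eq_mul, smul_eq_mul, mul_comm]

omit [CharZero K] in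
/-- If every index of `l` has `hdeg = r`, the diagonal operator acts on `l` by `r`. [cite: LooijengaLunts1997, §1 p. 4 (the degree operator h of a graded module)] -/
theorem colOp_diagCol_of_all (hdeg : ℕ → ℚ) (r : ℚ) :
    ∀ (l : SpVec), (l.all fun q ↦ hdeg q.1 == r) = true →
      colOp K (diagCol hdeg) (toF K l) = (r : K) • toF K l := by
  intro l
  induction l with
  | nil => intro _; simp
  | cons q t ih =>
    intro h
    simp only [List.all_cons, Bool.and_eq_true, beq_iff_eq] at h
    rw [toF_cons, map_add, smul_add, ih (by simpa using h.2), colOp_diagCol_single, h.1]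

/-- Basis-vector check of `[E, F] = H` (`H` diagonal with eigenvalue `hdeg`): the residual
`E(F δ_i) - F(E δ_i) - hdeg(i) δ_i` normalises to the empty list (pure list computation, for the
small columns of basis vectors). [cite: LooijengaLunts1997, §1 p. 4 (the sl₂-triple (e, h, f))] -/
def basisSl2Check (E F : ℕ → SpVec) (hdeg : ℕ → ℚ) (i : ℕ) : Bool :=
  (normalize (applyCols E (F i) ++ scale (-1) (applyCols F (E i)) ++ [(i, -hdeg i)])).isEmpty

/-- Soundness of `basisSl2Check`: `E (F δ_i) - F (E δ_i) = hdeg(i) • δ_i`. [cite: LooijengaLunts1997, §1 p. 4 (the sl₂-triple (e, h, f))] -/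
theorem basisSl2Check_sound {E F : ℕ → SpVec} {hdeg : ℕ → ℚ} {i : ℕ} (h : basisSl2Check E F hdeg i = true) :
    colOp K E (colOp K F (Finsupp.single i 1)) - colOp K F (colOp K E (Finsupp.single i 1)) =
      (hdeg i : K) • Finsupp.single i 1 := by
  unfold basisSl2Check at h
  rw [List.isEmpty_iff] at h
  have hz := toF_eq_zero_of_normalize_eq_nil K h
  rw [toF_append, toF_append, toF_scale, toF_applyCols, toF_applyCols, toF_cons, toF_nil, add_zero,
    Rat.cast_neg, Rat.cast_one, neg_one_smul] at hz
  rw [colOp_single, colOp_single, one_smul, one_smul, Finsupp.smul_single, smul_eq_mul, mul_one]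
  -- hz : a + -b + single i (-hdeg i) = 0
  rw [Rat.cast_neg, Finsupp.single_neg] at hz
  have : colOp K E (toF K (F i)) - colOp K F (toF K (E i)) - Finsupp.single i (hdeg i : K) = 0 := by
    rw [← hz]; abel
  exact sub_eq_zero.mp this

/-- Basis-vector check that `F` shifts the `hdeg`-eigenvalue by `d`: every index of the column `F i`
has `hdeg = hdeg i + d`. [cite: LooijengaLunts1997, §1 p. 4 (operators of degree ±2)] -/
def basisShiftCheck (F : ℕ → SpVec) (hdeg : ℕ → ℚ) (d : ℚ) (i : ℕ) : Bool :=
  (F i).all fun q ↦ hdeg q.1 == hdeg i + d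

/-- Soundness of `basisShiftCheck`: `H (F δ_i) - F (H δ_i) = d • F δ_i` (`H` = the diagonal operator).
[cite: LooijengaLunts1997, §1 p. 4 (operators of degree ±2)] -/
theorem basisShiftCheck_sound {F : ℕ → SpVec} {hdeg : ℕ → ℚ} {d : ℚ} {i : ℕ}
    (h : basisShiftCheck F hdeg d i = true) :
    colOp K (diagCol hdeg) (colOp K F (Finsupp.single i 1)) -
        colOp K F (colOp K (diagCol hdeg) (Finsupp.single i 1)) =
      (d : K) • colOp K F (Finsupp.single i 1) := by
  unfold basisShiftCheck at h
  rw [colOp_diagCol_single, map_smul, colOp_single, one_smul, colOp_diagCol_of_all K hdeg _ _ h,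
    Rat.cast_add, add_smul]
  abel


end Literature.Computation.Sparse
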